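import Summits.NavierStokesRegularity.NavierStokesRegularity.Theorems.ScenarioCensusRowF1SocketRows
import Summits.NavierStokesRegularity.NavierStokesRegularity.Theorems.ScenarioCensusRowF1IntStretchBudget
import HarnessLib

/-!
# LINE 27 «liouville-socket» port, part 5/5: §11 (end) corollaries in kernel (`rowF1_subSelfSimilarSpeed`, `rowF1_slowCrossFlowTop`, `rowF1_nearBeltramiTop`), the
# SCALE-INVARIANT VOLUME row `Row_F1vol` / `rowF1vol_holds` and its floor `DivergentFastVolume`; census KEYS `Row_F1sp` / `Row_F1xf` / `Row_F1vol` + `_excluded`, floors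

Re-homed for the scenario census (typer seat ns-census-typer-1 g9; the cells F1sp / F1vol / F1xf and the floors DSE / DFV / DXE are MEMBERS OF RECORD «DECIDED IN KERNEL IN
FILES» of row F1 since census v1.80 (critic idea-crit-3 g8 PASS — no price; ref ns-census-ref g11 PRE-CHECK ✓ §16.2 item 48; lead-presearch label); this port makes them
TREE-decided): VERBATIM PORT of ns-idea-3 LINE 27 «liouville-socket», `pub/ideators/ns-idea-3/lines/liouville-socket/line-liouville-socket.lean` sha16 01bcb6dd501a8321
(1929 l., lean check rc 0, 0 sorry), split for the 400-line rule into five parts `ScenarioCensusRowF1Socket{∅, Readout, Kill, Rows, Top}` (chain imports).  Lean text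
VERBATIM in namespace `…Theorems.ScenarioCensus.LiouvilleSocket` (the line's `…Cruxes.ScenarioCensusRowF1.LiouvilleSocketLine` re-homed); port edits: the bracket lines
`section …` / `end …` dropped (no `variable`s), `@[conjecture]` on the residual `SocketSlack` (≡ `ScenarioCensus.Row_F1`, OPEN), one-line docstrings added where missing
(gate lint); after review p713151 three one-line helpers (`le_of_sq_le_sq'`, `cross_zero_left`, `continuous_cross₂`) are replaced by Mathlib's `le_of_sq_le_sq` / local `have`s and `cross_smul_smul` is the tree's `UnthreadedRigidity.ThreadingJets.cross_smul_smul` BY NAME; lemmas the line shares VERBATIM with the landed inviscid-top / frozen-top / columnar-top / stretched-top / integrated-stretch ports are taken BY NAME (listed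
below).  Statements untouched.

No census VALUE is moved here (row F1 stays OPEN-WITH-LINE; the members become TREE-decided by name); NS regularity is NOT proved; `Row_F1` is untouched (zero
movement, `socketSlack_iff_rowF1`); no summit statement is proved by this file. Lemmas that restate already-landed tree declarations are taken BY NAME (gate lint `dedup.landed`): `fderiv_smul_stPull_apply` = `InviscidTop.fderiv_smul_stPull_apply`, `fderiv_smul_stPull` = `InviscidTop.fderiv_smul_stPull`, `fderiv_fderiv_smul_stPull` = `InviscidTop.fderiv_fderiv_smul_stPull`, `tendsto_clm_of_tendsto_apply` = `InviscidTop.tendsto_clm_of_tendsto_apply`, `tendsto_fderiv_fderiv_apply_of_bound` = `InviscidTop.tendsto_fderiv_fderiv_apply_of_bound`, `tendsto_fderiv_fderiv_of_bound` = `InviscidTop.tendsto_fderiv_fderiv_of_bound`, `tendsto_fderiv_fderiv_of_typeI_seq_Ioo` = `InviscidTop.tendsto_fderiv_fderiv_of_typeI_seq_Ioo`, `fderiv3_smul_stPull` = `FrozenTop.fderiv3_smul_stPull`, `tendsto_fderiv3_of_typeI_seq_Ioo` = `FrozenTop.tendsto_fderiv3_of_typeI_seq_Ioo`, `tendsto_physicalTime`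 = `ColumnarTop.tendsto_physicalTime`, `eventually_fast` = `ColumnarTop.eventually_fast`, `sqrt_timeLag` = `StretchedTop.sqrt_timeLag`, `forall_of_forall_ne_zero` = `StretchedTop.forall_of_forall_ne_zero`, `radius_eq` = `FrozenTop.radius_eq`, `jointCond_everywhere₆` = `FrozenTop.jointCond_everywhere₄`, `continuousOn_quad` = `IntegratedStretch.continuousOn_quad`, `sqrt_nu_timeLag` = `IntegratedStretch.sqrt_nu_timeLag`, `sing_of_not_bounded` = `InviscidTop.sing_of_not_bounded`, `exists_singularZoom_package₃` = `FrozenTop.exists_singularZoom_package₃`, `lapD_eq_zero_of_eq_zero` = `FrozenTop.lapD_eq_zero_of_eq_zero`, `measurableSet_top` = `IntegratedStretch.measurableSet_top`, `cross_smul_smul` = `UnthreadedRigidity.ThreadingJets.cross_smul_smul`.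
-/

-- the summit and its single problem share the name `NavierStokesRegularity` (D-0017 nested layout)
set_option linter.dupNamespace false

noncomputable section

open MeasureTheory Set Function Filter TopologicalSpace Metric
open scoped Topology NNReal ENNReal InnerProductSpace RealInnerProductSpace Laplacian

namespace Summit.NavierStokesRegularity.NavierStokesRegularity.Theorems.ScenarioCensus.LiouvilleSocket

open Literature.Analysis Literature.Analysis.FluidPDE
open Summit.NavierStokesRegularity.NavierStokesRegularity.Theorems

/-! ### Corollaries in kernel -/

/-- **SUB-SELF-SIMILAR SPEED near `T`** (the pointwise corner of row F1sp, level-free; NOT claimed new — in `liminf`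
form with Leray's constant this is Leray's 1934 rate floor; here the constant is the tree's threshold `1` in units
`√ν` and only `[t₀, T)`-pointwise control is asked): a Clay solution with Type-I blow-up control at `T` and
`|u(t, x)|² ≤ κ ν/(T − t)` on `[t₀, T) × ℝ³` for some `κ < 1` extends smoothly past `T`. -/
theorem rowF1_subSelfSimilarSpeed : ∀ (ν T : ℝ), 0 < ν → 0 < T → ∀ (u : ℝ → E3 → E3) (p : ℝ → E3 → ℝ),
    IsClassicalNSSolutionOn (Ico 0 T) ν 0 u p → IsLerayHopfOn T ν 0 (u 0) u →
    HasRapidSpatialDecay (u 0) → IsTypeIBlowup u T →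
    (∃ κ t₀ : ℝ, κ < 1 ∧ 0 ≤ t₀ ∧ t₀ < T ∧ ∀ t ∈ Ico t₀ T, ∀ x, ‖u t x‖ ^ 2 ≤ κ * (ν * (T - t)⁻¹)) →
    HasSmoothExtensionPast ν 0 u T := by
  intro ν T hν hT u p hsol hLH hdec hTI h
  obtain ⟨κ, t₀, hκ, ht₀, ht₀T, hb⟩ := h
  refine rowF1sp_holds ν T hν hT u p hsol hLH hdec hTI ⟨κ, t₀, fun _ => 0, hκ, ht₀, ht₀T,
    isSubcriticalLevel_const T 0, measurable_const, ?_⟩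
  have h0 : ∀ z, spdIntegrand T ν κ t₀ (fun _ => 0) u z = 0 := by
    intro z
    unfold spdIntegrand
    by_cases hz : z ∈ {z : ℝ × E3 | z.1 ∈ Ico t₀ T ∧ (fun _ : ℝ => (0 : ℝ)) z.1 < ‖u z.1 z.2‖}
    · rw [indicator_of_mem hz]
      have hle : ((T - z.1) ^ 2)⁻¹ * (‖u z.1 z.2‖ ^ 2 - κ * (ν * (T - z.1)⁻¹)) ≤ 0 :=
        mul_nonpos_of_nonneg_of_nonpos (inv_nonneg.2 (sq_nonneg _)) (by linarith [hb z.1 hz.1 z.2])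
      rw [max_eq_left hle, mul_zero, ENNReal.ofReal_zero]
    · rw [indicator_of_notMem hz]
  rw [lintegral_congr h0, lintegral_zero]
  exact ENNReal.zero_lt_top

/-- **SLOW CROSS-FLOW TOP** (the eventual pointwise corner of row F1xf): Type I + for some `κ < 1`, `t₀ ∈ [0, T)` and
some measurable subcritical level, at every fast point of `[t₀, T) × ℝ³` the fluid crosses its own vortex lines slower
than `√κ` times the self-similar speed (`‖ω × u‖² ≤ κ ν |ω|²/(T − t)`) ⇒ smooth extension. -/
theorem rowF1_slowCrossFlowTop : ∀ (ν T : ℝ), 0 < ν → 0 < T → ∀ (u : ℝ → E3 → E3) (p : ℝ → E3 → ℝ),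
    IsClassicalNSSolutionOn (Ico 0 T) ν 0 u p → IsLerayHopfOn T ν 0 (u 0) u →
    HasRapidSpatialDecay (u 0) → IsTypeIBlowup u T →
    (∃ (κ t₀ : ℝ) (Λ : ℝ → ℝ), κ < 1 ∧ 0 ≤ t₀ ∧ t₀ < T ∧ IsSubcriticalLevel T Λ ∧ Measurable Λ ∧
      ∀ t ∈ Ico t₀ T, ∀ x, Λ t < ‖u t x‖ →
        ‖cross (curl (u t) x) (u t x)‖ ^ 2 ≤ κ * (ν * (T - t)⁻¹ * ‖curl (u t) x‖ ^ 2)) →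
    HasSmoothExtensionPast ν 0 u T := by
  intro ν T hν hT u p hsol hLH hdec hTI h
  obtain ⟨κ, t₀, Λ, hκ, ht₀, ht₀T, hΛ, hΛm, hb⟩ := h
  refine rowF1xf_holds ν T hν hT u p hsol hLH hdec hTI ⟨κ, t₀, Λ, hκ, ht₀, ht₀T, hΛ, hΛm, ?_⟩
  have h0 : ∀ z, xflIntegrand T ν κ t₀ Λ u z = 0 := by
    intro z
    unfold xflIntegrand
    by_cases hz : z ∈ {z : ℝ × E3 | z.1 ∈ Ico t₀ T ∧ Λ z.1 < ‖u z.1 z.2‖}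
    · rw [indicator_of_mem hz]
      have hle : ‖cross (curl (u z.1) z.2) (u z.1 z.2)‖ ^ 2 - κ * (ν * (T - z.1)⁻¹ * ‖curl (u z.1) z.2‖ ^ 2) ≤ 0 := by
        linarith [hb z.1 hz.1 z.2 hz.2]
      rw [max_eq_left hle, mul_zero, ENNReal.ofReal_zero]
    · rw [indicator_of_notMem hz]
  rw [lintegral_congr h0, lintegral_zero]
  exact ENNReal.zero_lt_top

/-- **NEAR-BELTRAMI TOP with a FIXED angle** (corner of row F1xf; compare census row F14′ = Farhat–Grujić, where the
angle bound must decay like `‖∇u(t)‖₂^{−1/2}` in the BKM class): a Type-I(M) Clay blow-up (`√(T − t)|u| ≤ M√ν`)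
whose fast fluid keeps `sin∠(u, ω) ≤ a` with a FIXED `a < 1/M` on `[t₀, T)` cannot occur — since then
`‖ω × u‖² ≤ a²|ω|²|u|² ≤ (aM)² ν|ω|²/(T − t)` with `(aM)² < 1`. -/
theorem rowF1_nearBeltramiTop : ∀ (ν T : ℝ), 0 < ν → 0 < T → ∀ (u : ℝ → E3 → E3) (p : ℝ → E3 → ℝ),
    IsClassicalNSSolutionOn (Ico 0 T) ν 0 u p → IsLerayHopfOn T ν 0 (u 0) u →
    HasRapidSpatialDecay (u 0) →
    (∃ (M a t₀ : ℝ) (Λ : ℝ → ℝ), 0 ≤ a ∧ a * M < 1 ∧ 0 ≤ t₀ ∧ t₀ < T ∧ IsSubcriticalLevel T Λ ∧ Measurable Λ ∧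
      (∀ t ∈ Ico t₀ T, ∀ x, Real.sqrt (T - t) * ‖u t x‖ ≤ M * Real.sqrt ν) ∧
      ∀ t ∈ Ico t₀ T, ∀ x, Λ t < ‖u t x‖ →
        ‖cross (curl (u t) x) (u t x)‖ ≤ a * (‖curl (u t) x‖ * ‖u t x‖)) →
    HasSmoothExtensionPast ν 0 u T := by
  intro ν T hν hT u p hsol hLH hdec h
  obtain ⟨M, a, t₀, Λ, ha, haM, ht₀, ht₀T, hΛ, hΛm, hTI, hang⟩ := h
  -- the Type-I frame hypothesis of `Row_F1` from the `[t₀, T)` bound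
  have hTIb : IsTypeIBlowup u T := by
    refine (IsTypeIBlowupWith.isTypeIBlowup (M := M) (ν := ν) ?_)
    have hmem : Ico t₀ T ∈ 𝓝[<] T := by
      rw [mem_nhdsLT_iff_exists_Ioo_subset]
      exact ⟨t₀, ht₀T, fun t ht => ⟨ht.1.le, ht.2⟩⟩
    filter_upwards [hmem] with t ht x using hTI t ht x
  have hM0 : 0 ≤ M := by
    have h1 := hTI t₀ ⟨le_rfl, ht₀T⟩ 0
    have h2 : 0 ≤ M * Real.sqrt ν := le_trans (mul_nonneg (Real.sqrt_nonneg _) (norm_nonneg _)) h1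
    by_contra hneg
    have : M * Real.sqrt ν < 0 := mul_neg_of_neg_of_pos (not_le.1 hneg) (Real.sqrt_pos.2 hν)
    linarith
  refine rowF1_slowCrossFlowTop ν T hν hT u p hsol hLH hdec hTIb
    ⟨(a * M) ^ 2, t₀, Λ, pow_lt_one₀ (mul_nonneg ha hM0) haM two_ne_zero, ht₀, ht₀T, hΛ, hΛm,
      fun t ht x hx => ?_⟩
  · have hσ : 0 < T - t := sub_pos.2 ht.2
    have hs : 0 < Real.sqrt (T - t) := Real.sqrt_pos.2 hσ
    have hub : ‖u t x‖ ≤ M * Real.sqrt ν / Real.sqrt (T - t) := by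
      rw [le_div_iff₀ hs, mul_comm]; exact hTI t ht x
    have hM0 : 0 ≤ M * Real.sqrt ν := le_trans (mul_nonneg hs.le (norm_nonneg _)) (hTI t ht x)
    have h1 := hang t ht x hx
    have h2 : ‖cross (curl (u t) x) (u t x)‖ ≤ a * ‖curl (u t) x‖ * (M * Real.sqrt ν / Real.sqrt (T - t)) := by
      calc ‖cross (curl (u t) x) (u t x)‖ ≤ a * (‖curl (u t) x‖ * ‖u t x‖) := h1
        _ = a * ‖curl (u t) x‖ * ‖u t x‖ := by ring
        _ ≤ a * ‖curl (u t) x‖ * (M * Real.sqrt ν / Real.sqrt (T - t)) :=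
            mul_le_mul_of_nonneg_left hub (mul_nonneg ha (norm_nonneg _))
    have h3 : 0 ≤ a * ‖curl (u t) x‖ * (M * Real.sqrt ν / Real.sqrt (T - t)) :=
      mul_nonneg (mul_nonneg ha (norm_nonneg _)) (div_nonneg hM0 hs.le)
    have h4 : ‖cross (curl (u t) x) (u t x)‖ ^ 2 ≤ (a * ‖curl (u t) x‖ * (M * Real.sqrt ν / Real.sqrt (T - t))) ^ 2 :=
      pow_le_pow_left₀ (norm_nonneg _) h2 2
    have h5 : (a * ‖curl (u t) x‖ * (M * Real.sqrt ν / Real.sqrt (T - t))) ^ 2 =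
        (a * M) ^ 2 * (ν * (T - t)⁻¹ * ‖curl (u t) x‖ ^ 2) := by
      rw [mul_pow, mul_pow, div_pow, mul_pow, Real.sq_sqrt hν.le, Real.sq_sqrt hσ.le]
      field_simp
    rw [h5] at h4
    exact h4

/-! ### The SCALE-INVARIANT VOLUME row and floor (order 0, level-free, explicit threshold) -/

/-- The **SCALE-INVARIANT VOLUME ELEMENT OF THE SUPER-`κ`-SELF-SIMILAR SET** on `[t₀, T)`:
`𝟙{t ∈ [t₀,T), |u(t,x)|² > κ ν/(T − t)} · √(T − t) (T − t)⁻³` (`= (T − t)^{−5/2} dx dt`, the parabolic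
scale-invariant measure, restricted to where the speed beats `√κ` times the self-similar speed). -/
def volIntegrand (T ν κ t₀ : ℝ) (u : ℝ → E3 → E3) : ℝ × E3 → ℝ≥0∞ :=
  {z : ℝ × E3 | z.1 ∈ Ico t₀ T ∧ κ * (ν * (T - z.1)⁻¹) < ‖u z.1 z.2‖ ^ 2}.indicator fun z =>
    ENNReal.ofReal (Real.sqrt (T - z.1) * ((T - z.1) ^ 3)⁻¹)

/-- **Criterion row F1vol** (order 0, level-free, explicit): the frame of `Row_F1` plus — for some `κ < 1` and some
`t₀ ∈ [0, T)`, the super-`κ`-self-similar set `{|u|² > κν/(T − t)}` has FINITE scale-invariant volume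
`∬ (T − t)^{−5/2} dx dt` on `[t₀, T) × ℝ³` — ⇒ smooth extension.  PROVED (`rowF1vol_holds`). -/
def Row_F1vol : Prop :=
  ∀ (ν T : ℝ), 0 < ν → 0 < T → ∀ (u : ℝ → E3 → E3) (p : ℝ → E3 → ℝ),
    IsClassicalNSSolutionOn (Ico 0 T) ν 0 u p → IsLerayHopfOn T ν 0 (u 0) u →
    HasRapidSpatialDecay (u 0) → IsTypeIBlowup u T →
    (∃ κ t₀ : ℝ, κ < 1 ∧ 0 ≤ t₀ ∧ t₀ < T ∧ ∫⁻ z, volIntegrand T ν κ t₀ u z < ⊤) →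
    HasSmoothExtensionPast ν 0 u T

/-- **INFINITE SCALE-INVARIANT VOLUME ABOVE EVERY FRACTION OF THE SELF-SIMILAR SPEED** (structural floor, maximal
frame): a maximal Type-I Clay blow-up gives, for EVERY `κ < 1` and every `t₀ ∈ [0, T)`,
`∬_{[t₀,T) × ℝ³, |u|² > κν/(T − t)} (T − t)^{−5/2} dx dt = ∞`.  PROVED (`divergentFastVolume_holds`). -/
def DivergentFastVolume : Prop :=
  ∀ (ν T : ℝ), 0 < ν → 0 < T → ∀ (u : ℝ → E3 → E3) (p : ℝ → E3 → ℝ),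
    IsMaximalSmoothSolution ν 0 u p T → IsLerayHopfOn T ν 0 (u 0) u →
    HasRapidSpatialDecay (u 0) → IsTypeIBlowup u T →
    ∀ κ : ℝ, κ < 1 → ∀ t₀ : ℝ, 0 ≤ t₀ → t₀ < T → ∫⁻ z, volIntegrand T ν κ t₀ u z = ⊤

/-- The volume element is ANTITONE in `κ` (as a set indicator). -/
theorem volIntegrand_mono {κ κ' : ℝ} (h : κ ≤ κ') {T ν : ℝ} (hν : 0 ≤ ν) (t₀ : ℝ) (u : ℝ → E3 → E3)
    (z : ℝ × E3) : volIntegrand T ν κ' t₀ u z ≤ volIntegrand T ν κ t₀ u z := by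
  unfold volIntegrand
  by_cases hz : z ∈ {z : ℝ × E3 | z.1 ∈ Ico t₀ T ∧ κ' * (ν * (T - z.1)⁻¹) < ‖u z.1 z.2‖ ^ 2}
  · have hσ : 0 < T - z.1 := sub_pos.2 hz.1.2
    have hz' : z ∈ {z : ℝ × E3 | z.1 ∈ Ico t₀ T ∧ κ * (ν * (T - z.1)⁻¹) < ‖u z.1 z.2‖ ^ 2} := by
      refine ⟨hz.1, lt_of_le_of_lt ?_ hz.2⟩
      exact mul_le_mul_of_nonneg_right h (mul_nonneg hν (inv_nonneg.2 hσ.le))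
    rw [indicator_of_mem hz, indicator_of_mem hz']
  · rw [indicator_of_notMem hz]
    exact bot_le

/-- **Domination**: under a Type-I bound `√(T − t)|u| ≤ M√ν` on `[t₁, T)`, for `κ ≥ 0` the speed-excess integrand at
the zero level on `[t₁, T)` is at most `M²ν` times the scale-invariant volume element of the super-`κ` set on any
`[t₀, T) ⊇ [t₁, T)`. -/
theorem spdIntegrand_le_volIntegrand {T ν M κ t₀ t₁ : ℝ} (hν : 0 < ν) (hκ : 0 ≤ κ) (h01 : t₀ ≤ t₁)
    {u : ℝ → E3 → E3} (hTI : ∀ t ∈ Ico t₁ T, ∀ x, Real.sqrt (T - t) * ‖u t x‖ ≤ M * Real.sqrt ν) (z : ℝ × E3) :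
    spdIntegrand T ν κ t₁ (fun _ => 0) u z ≤ ENNReal.ofReal (M ^ 2 * ν) * volIntegrand T ν κ t₀ u z := by
  unfold spdIntegrand volIntegrand
  by_cases hz : z ∈ {z : ℝ × E3 | z.1 ∈ Ico t₁ T ∧ (fun _ : ℝ => (0 : ℝ)) z.1 < ‖u z.1 z.2‖}
  · rw [indicator_of_mem hz]
    have hσ : 0 < T - z.1 := sub_pos.2 hz.1.2
    have hs : 0 < Real.sqrt (T - z.1) := Real.sqrt_pos.2 hσ
    by_cases hE : κ * (ν * (T - z.1)⁻¹) < ‖u z.1 z.2‖ ^ 2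
    · have hzE : z ∈ {z : ℝ × E3 | z.1 ∈ Ico t₀ T ∧ κ * (ν * (T - z.1)⁻¹) < ‖u z.1 z.2‖ ^ 2} :=
        ⟨⟨h01.trans hz.1.1, hz.1.2⟩, hE⟩
      rw [indicator_of_mem hzE, ← ENNReal.ofReal_mul (mul_nonneg (sq_nonneg M) hν.le)]
      refine ENNReal.ofReal_le_ofReal ?_
      -- `|u|² ≤ M²ν/(T − t)` from the Type-I bound
      have hub : ‖u z.1 z.2‖ ^ 2 ≤ M ^ 2 * ν * (T - z.1)⁻¹ := by
        have h1 := hTI z.1 hz.1 z.2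
        have h0 : 0 ≤ Real.sqrt (T - z.1) * ‖u z.1 z.2‖ := mul_nonneg hs.le (norm_nonneg _)
        have h2 : (Real.sqrt (T - z.1) * ‖u z.1 z.2‖) ^ 2 ≤ (M * Real.sqrt ν) ^ 2 := pow_le_pow_left₀ h0 h1 2
        rw [mul_pow, mul_pow, Real.sq_sqrt hσ.le, Real.sq_sqrt hν.le] at h2
        rw [le_mul_inv_iff₀ hσ, mul_comm]
        linarith
      have hex : max 0 (((T - z.1) ^ 2)⁻¹ * (‖u z.1 z.2‖ ^ 2 - κ * (ν * (T - z.1)⁻¹))) ≤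
          ((T - z.1) ^ 2)⁻¹ * (M ^ 2 * ν * (T - z.1)⁻¹) := by
        refine max_le (mul_nonneg (inv_nonneg.2 (sq_nonneg _)) ?_) (mul_le_mul_of_nonneg_left ?_
          (inv_nonneg.2 (sq_nonneg _)))
        · exact mul_nonneg (mul_nonneg (sq_nonneg M) hν.le) (inv_nonneg.2 hσ.le)
        · have : 0 ≤ κ * (ν * (T - z.1)⁻¹) := mul_nonneg hκ (mul_nonneg hν.le (inv_nonneg.2 hσ.le))
          linarith
      calc Real.sqrt (T - z.1) * max 0 (((T - z.1) ^ 2)⁻¹ * (‖u z.1 z.2‖ ^ 2 - κ * (ν * (T - z.1)⁻¹)))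
          ≤ Real.sqrt (T - z.1) * (((T - z.1) ^ 2)⁻¹ * (M ^ 2 * ν * (T - z.1)⁻¹)) :=
            mul_le_mul_of_nonneg_left hex hs.le
        _ = M ^ 2 * ν * (Real.sqrt (T - z.1) * ((T - z.1) ^ 3)⁻¹) := by
            have hσ' : T - z.1 ≠ 0 := hσ.ne'
            field_simp
    · -- off the super-`κ` set the excess vanishes
      have hle : ((T - z.1) ^ 2)⁻¹ * (‖u z.1 z.2‖ ^ 2 - κ * (ν * (T - z.1)⁻¹)) ≤ 0 :=
        mul_nonpos_of_nonneg_of_nonpos (inv_nonneg.2 (sq_nonneg _)) (by linarith [not_lt.1 hE])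
      rw [max_eq_left hle, mul_zero, ENNReal.ofReal_zero]
      exact bot_le
  · rw [indicator_of_notMem hz]
    exact bot_le

/-- **Criterion row F1vol is EXCLUDED** (in kernel): finite scale-invariant volume of the super-`κ` set ⇒ (Type-I
domination on a late window `[t₁, T)`) integrable speed excess at the zero level ⇒ row F1sp. -/
theorem rowF1vol_holds : Row_F1vol := by
  intro ν T hν hT u p hsol hLH hdec hTI h
  obtain ⟨κ, t₀, hκ, ht₀, ht₀T, hfin⟩ := h
  -- a late window `[t₁, T)` on which a Type-I bound with some dimensionless constant holds
  obtain ⟨M, hM⟩ := exists_isTypeIBlowupWith hν hTI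
  obtain ⟨l, hlT, hl⟩ := mem_nhdsLT_iff_exists_Ioo_subset.1 hM
  have hlT' : l < T := hlT
  set t₁ : ℝ := max t₀ ((l + T) / 2) with ht₁
  have h01 : t₀ ≤ t₁ := le_max_left _ _
  have ht₁T : t₁ < T := max_lt ht₀T (by linarith)
  have ht₁0 : 0 ≤ t₁ := ht₀.trans h01
  have hlt₁ : l < t₁ := lt_of_lt_of_le (by linarith) (le_max_right _ _)
  have hTIb : ∀ t ∈ Ico t₁ T, ∀ x, Real.sqrt (T - t) * ‖u t x‖ ≤ M * Real.sqrt ν :=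
    fun t ht x => hl ⟨hlt₁.trans_le ht.1, ht.2⟩ x
  -- pass to `κ₊ = max κ 0`
  have hκ' : max κ 0 < 1 := max_lt hκ zero_lt_one
  have hfin' : ∫⁻ z, volIntegrand T ν (max κ 0) t₀ u z < ⊤ :=
    lt_of_le_of_lt (lintegral_mono fun z => volIntegrand_mono (le_max_left κ 0) hν.le t₀ u z) hfin
  refine rowF1sp_holds ν T hν hT u p hsol hLH hdec hTI ⟨max κ 0, t₁, fun _ => 0, hκ', ht₁0, ht₁T,
    isSubcriticalLevel_const T 0, measurable_const, ?_⟩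
  calc ∫⁻ z, spdIntegrand T ν (max κ 0) t₁ (fun _ => 0) u z
      ≤ ∫⁻ z, ENNReal.ofReal (M ^ 2 * ν) * volIntegrand T ν (max κ 0) t₀ u z :=
        lintegral_mono fun z => spdIntegrand_le_volIntegrand hν (le_max_right κ 0) h01 hTIb z
    _ = ENNReal.ofReal (M ^ 2 * ν) * ∫⁻ z, volIntegrand T ν (max κ 0) t₀ u z :=
        lintegral_const_mul' _ _ ENNReal.ofReal_ne_top
    _ < ⊤ := ENNReal.mul_lt_top ENNReal.ofReal_lt_top hfin'

/-- **The floor INFINITE SCALE-INVARIANT VOLUME ABOVE EVERY FRACTION OF THE SELF-SIMILAR SPEED holds.** -/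
theorem divergentFastVolume_holds : DivergentFastVolume := by
  intro ν T hν hT u p hmax hLH hdec hTI κ hκ t₀ ht₀ ht₀T
  by_contra hne
  exact hmax.2 (rowF1vol_holds ν T hν hT u p hmax.1 hLH hdec hTI ⟨κ, t₀, hκ, ht₀, ht₀T, lt_top_iff_ne_top.2 hne⟩)

/-- Row F1 from row F1vol's residual form: (maximal Type-I Clay blow-ups have a super-`κ` set of finite
scale-invariant volume for some `κ < 1`) ⇒ `Row_F1`. -/
theorem rowF1_of_volumeSlack
    (h : ∀ (ν T : ℝ), 0 < ν → 0 < T → ∀ (u : ℝ → E3 → E3) (p : ℝ → E3 → ℝ),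
      IsMaximalSmoothSolution ν 0 u p T → IsLerayHopfOn T ν 0 (u 0) u →
      HasRapidSpatialDecay (u 0) → IsTypeIBlowup u T →
      ∃ κ t₀ : ℝ, κ < 1 ∧ 0 ≤ t₀ ∧ t₀ < T ∧ ∫⁻ z, volIntegrand T ν κ t₀ u z < ⊤) :
    ScenarioCensus.Row_F1 := by
  unfold ScenarioCensus.Row_F1
  intro ν T hν hT u p hsol hLH hdec hTI
  by_contra hext
  exact hext (rowF1vol_holds ν T hν hT u p hsol hLH hdec hTI (h ν T hν hT u p ⟨hsol, hext⟩ hLH hdec hTI))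

end Summit.NavierStokesRegularity.NavierStokesRegularity.Theorems.ScenarioCensus.LiouvilleSocket

namespace Summit.NavierStokesRegularity.NavierStokesRegularity.Theorems.ScenarioCensus

/-! ## Census KEYS (ns `…Theorems.ScenarioCensus`): the LIOUVILLE-SOCKET members of row F1 — TREE-decided F1sp / F1xf / F1vol and floors DSE / DXE / DFV -/

/-- **Cell F1sp** (row F1 frame VERBATIM + for some `κ < 1`, `t₀ ∈ [0,T)` and a measurable subcritical level, the SPEED EXCESS of the fast fluid over `κν/(T−t)` is integrable against `√(T−t)(T−t)⁻²` on `[t₀,T) × ℝ³` ⇒ smooth extension past `T`): `:= LiouvilleSocket.Row_F1sp`. DECIDED. -/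
def Row_F1sp : Prop := LiouvilleSocket.Row_F1sp
/-- F1sp is EXCLUDED (decided in the tree): `LiouvilleSocket.rowF1sp_holds`. -/
theorem row_F1sp_excluded : Row_F1sp := LiouvilleSocket.rowF1sp_holds

/-- **Cell F1xf** (row F1 frame + an integrable enstrophy-weighted CROSS-FLOW EXCESS of the fast fluid, order 1): `:= LiouvilleSocket.Row_F1xf`. DECIDED. -/
def Row_F1xf : Prop := LiouvilleSocket.Row_F1xf
/-- F1xf is EXCLUDED (decided in the tree): `LiouvilleSocket.rowF1xf_holds`. -/
theorem row_F1xf_excluded : Row_F1xf := LiouvilleSocket.rowF1xf_holds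

/-- **Cell F1vol** (row F1 frame + for some `κ < 1`, `t₀`: the super-`κ`-self-similar set `{|u|² > κν/(T−t)}` has FINITE scale-invariant volume `∬ (T−t)^{−5/2}` on `[t₀,T) × ℝ³`): `:= LiouvilleSocket.Row_F1vol`. DECIDED. -/
def Row_F1vol : Prop := LiouvilleSocket.Row_F1vol
/-- F1vol is EXCLUDED (decided in the tree): `LiouvilleSocket.rowF1vol_holds`. -/
theorem row_F1vol_excluded : Row_F1vol := LiouvilleSocket.rowF1vol_holds

/-- **Floor DSE — DIVERGENT SPEED EXCESS** at the level of the census keys: `LiouvilleSocket.divergentSpeedExcess_holds`. -/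
theorem row_F1_divergentSpeedExcess : LiouvilleSocket.DivergentSpeedExcess := LiouvilleSocket.divergentSpeedExcess_holds
/-- **Floor DXE — DIVERGENT CROSS-FLOW EXCESS**: `LiouvilleSocket.divergentCrossFlowExcess_holds`. -/
theorem row_F1_divergentCrossFlowExcess : LiouvilleSocket.DivergentCrossFlowExcess := LiouvilleSocket.divergentCrossFlowExcess_holds
/-- **Floor DFV — DIVERGENT FAST VOLUME** (infinite scale-invariant volume above every fraction of the self-similar speed): `LiouvilleSocket.divergentFastVolume_holds`. -/
theorem row_F1_divergentFastVolume : LiouvilleSocket.DivergentFastVolume := LiouvilleSocket.divergentFastVolume_holds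

end Summit.NavierStokesRegularity.NavierStokesRegularity.Theorems.ScenarioCensus

end
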